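import Summits.ResolutionOfSingularities.ResolutionOfSingularities.Theorems.WildQuotientsSummitReductionStubPairOrbitNormalFormBlowupModelCharts3
import Literature.AlgebraicGeometry.Resolution.NodalBlowupStrictTransformPrimes
import HarnessLib

/-!
# `WildQuotients.SummitReduction` (stmt-ResolutionOfSingularities-16324), line `FramePerfect`, stub NB1
# (`stub_pair_orbitNormalFormBlowup_modelSingularOverCentre`): test primes on the chart `z_a ≠ 0`
# — the strict transform of `V(z_u, z_v, z_b, z_k)`

Route `ResolutionOfSingularities/WildQuotients`, crux `SummitReduction`; fourth helper file of
stub NB1 = de Jong 1996, Claim 4.27 [C1] on the coefficient-free model. On the chart `z_a ≠ 0`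
of the set-up of `…OrbitNormalFormBlowupModelCharts.lean` the strict transforms of the other
singular branches `V(z_u, z_v, z_p, z_q)` are the prime ideals through which de Jong's last
sentence of 4.27 is proved ("The irreducible component `u' = v' = t₂' = t₃ = 0` of the singular
locus maps onto `u = v = t₂ = t₃ = 0`, the component `u' = v' = t₃ = t₄ = 0` is the strict
transform of the component `u = v = t₃ = t₄ = 0`"). They are realised as **test primes**: for a
ring map `θ : R[1/z_a] → 𝕂` to a field, `𝔯_θ = eval(ker Θ)` with
`Θ : R[T₀, T₁, T₃] → 𝕂` the induced evaluation (the relations of the chart lie in `ker Θ`,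
`blowupAlgebra.ker_eval_le_ker`). PROVED here:

* `MvPolynomial.sub_C_coeff_zero_mem_span_range_X`, `MvPolynomial.sub_aeval_aeval_mem_span` —
  killing all / all but one variable of `R[T]`;
* `isPrime_testPrime`, `algebraMap_mem_testPrime_iff`, `algebraMap_centre_notMem_testPrime`,
  `map_span_le_testPrime`, `strictTransformT_mem_testPrime` — `𝔯_θ` is a prime not containing
  `z_a`, containing the constants killed by `θ` and the strict transform `e₀ e₁ - e₃ h` as soon as
  `θ(z_u) = θ(h) = 0`;
* the concrete test maps `ψ_K : R → R/K → Frac(R/K)` (`test_comp_mk_eq_zero_iff`,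
  `isUnit_test_comp_mk`, `awayLift_algebraMap`);
* **`testPrime_le_caseA`** — for `K = (z_k, z_u, z_v, z_b)` and a prime `Q ∋ z_a, e₀, e₁, e₃, z_k`
  of the chart ring, `𝔯_{θ_K} ≤ Q` (an element of `ker Θ` is its constant term modulo the
  variables, and that constant lies in `K`).

## Sources

* A. J. de Jong, *Smoothness, semi-stability and alterations*, Publ. Math. IHÉS 83 (1996), 4.27,
  p. 76. [DeJong1996]
* A. J. de Jong, *Families of curves and alterations*, Ann. Inst. Fourier 47 (1997), proof of
  Prop. 5.11, p. 619. [DeJong1997]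
-/

set_option linter.dupNamespace false -- the tree's summit namespace repeats `ResolutionOfSingularities`

noncomputable section

open IsLocalRing

namespace Summit.ResolutionOfSingularities.ResolutionOfSingularities.Theorems

open Literature.AlgebraicGeometry.Resolution

/-! ## Polynomial bookkeeping on `R[T₀, T₁, T₃]` -/

section Poly

variable {R : Type} [CommRing R] {σ : Type}

/-- A polynomial minus its constant term lies in the ideal of the variables. [folklore] -/
theorem MvPolynomial.sub_C_coeff_zero_mem_span_range_X (m : MvPolynomial σ R) :
    m - MvPolynomial.C (m.coeff 0) ∈ Ideal.span (Set.range (MvPolynomial.X : σ → MvPolynomial σ R)) := by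
  classical
  rw [← Set.image_univ, MvPolynomial.mem_ideal_span_X_image]
  intro mono hmono
  by_contra hcon
  simp only [Set.mem_univ, true_and, not_exists, not_not] at hcon
  have h0 : mono = 0 := Finsupp.ext hcon
  rw [h0, MvPolynomial.mem_support_iff, MvPolynomial.coeff_sub, MvPolynomial.coeff_zero_C, sub_self] at hmono
  exact hmono rfl

/-- **Killing all variables but one**: `m ≡ ι(π m)` modulo the other variables, where `π`
substitutes `T_{j₀} ↦ Y` and `T_j ↦ 0` (`j ≠ j₀`) and `ι` substitutes `Y ↦ T_{j₀}`. [folklore] -/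
theorem MvPolynomial.sub_aeval_aeval_mem_span [DecidableEq σ] (j₀ : σ) (m : MvPolynomial σ R) :
    m - Polynomial.aeval (MvPolynomial.X j₀ : MvPolynomial σ R)
        (MvPolynomial.aeval (fun j : σ => if j = j₀ then (Polynomial.X : Polynomial R) else 0) m) ∈
      Ideal.span (MvPolynomial.X '' {j | j ≠ j₀}) := by
  induction m using MvPolynomial.induction_on with
  | C a =>
    rw [MvPolynomial.algHom_C, Polynomial.algebraMap_eq, Polynomial.aeval_C, MvPolynomial.algebraMap_eq,
      sub_self]
    exact Ideal.zero_mem _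
  | add p q hp hq =>
    rw [map_add, map_add]
    have : p + q - (Polynomial.aeval (MvPolynomial.X j₀ : MvPolynomial σ R)
        (MvPolynomial.aeval (fun j : σ => if j = j₀ then (Polynomial.X : Polynomial R) else 0) p) +
        Polynomial.aeval (MvPolynomial.X j₀ : MvPolynomial σ R)
        (MvPolynomial.aeval (fun j : σ => if j = j₀ then (Polynomial.X : Polynomial R) else 0) q)) =
        (p - Polynomial.aeval (MvPolynomial.X j₀ : MvPolynomial σ R)
        (MvPolynomial.aeval (fun j : σ => if j = j₀ then (Polynomial.X : Polynomial R) else 0) p)) +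
        (q - Polynomial.aeval (MvPolynomial.X j₀ : MvPolynomial σ R)
        (MvPolynomial.aeval (fun j : σ => if j = j₀ then (Polynomial.X : Polynomial R) else 0) q)) := by
      ring
    rw [this]
    exact Ideal.add_mem _ hp hq
  | mul_X p n hp =>
    rw [map_mul, map_mul, MvPolynomial.aeval_X]
    by_cases hn : n = j₀
    · subst hn
      rw [if_pos rfl, Polynomial.aeval_X, ← sub_mul]
      exact Ideal.mul_mem_right _ _ hp
    · rw [if_neg hn, map_zero, mul_zero, sub_zero]
      exact Ideal.mul_mem_left _ _ (Ideal.subset_span ⟨n, hn, rfl⟩)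

end Poly

/-! ## Test maps out of the chart ring `R[I/z_a]` -/

/-- The three variables `T₀, T₁, T₃` of the chart `z_a ≠ 0`. [folklore] -/
theorem Fin.subtype_ne_two_cases (j : {j : Fin 4 // j ≠ 2}) :
    j = ⟨0, by decide⟩ ∨ j = ⟨1, by decide⟩ ∨ j = ⟨3, by decide⟩ := by
  obtain ⟨j, hj⟩ := j
  fin_cases j
  · exact Or.inl rfl
  · exact Or.inr (Or.inl rfl)
  · exact absurd rfl hj
  · exact Or.inr (Or.inr rfl)


section TestMap

variable {R : Type} [CommRing R] {N : ℕ} {z : Fin N → R} {ι : Fin 4 → Fin N}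
  {𝕂 : Type} [Field 𝕂] (θ : Localization.Away ((z ∘ ι) 2) →+* 𝕂)

/-- The test evaluation `Θ : R[T₀, T₁, T₃] → 𝕂` attached to `θ : R[1/z_a] → 𝕂` takes `T_j` to
`θ(z_j/z_a)`, with `θ(z_j/z_a) · θ(z_a) = θ(z_j)`. [folklore] -/
theorem test_frac_mul (j : Fin 4) :
    θ (blowupAlgebra.frac (z ∘ ι) 2 j : Localization.Away ((z ∘ ι) 2)) *
        θ (algebraMap R (Localization.Away ((z ∘ ι) 2)) ((z ∘ ι) 2)) =
      θ (algebraMap R (Localization.Away ((z ∘ ι) 2)) ((z ∘ ι) j)) := by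
  rw [← map_mul, blowupAlgebra.coe_frac, div_mul_algebraMap]

/-- `θ(z_a) ≠ 0` (`z_a` is a unit of `R[1/z_a]`). [folklore] -/
theorem test_centre_ne_zero : θ (algebraMap R (Localization.Away ((z ∘ ι) 2)) ((z ∘ ι) 2)) ≠ 0 :=
  ((IsLocalization.Away.algebraMap_isUnit ((z ∘ ι) 2)).map θ).ne_zero

/-- `θ(z_j/z_a) = 0` iff `θ(z_j) = 0`. [folklore] -/
theorem test_frac_eq_zero_iff (j : Fin 4) :
    θ (blowupAlgebra.frac (z ∘ ι) 2 j : Localization.Away ((z ∘ ι) 2)) = 0 ↔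
      θ (algebraMap R (Localization.Away ((z ∘ ι) 2)) ((z ∘ ι) j)) = 0 := by
  rw [← test_frac_mul θ j, mul_eq_zero, or_iff_left (test_centre_ne_zero θ)]

/-- **The test prime** `𝔯_θ = eval(ker Θ) ⊆ R[I/z_a]` is a prime ideal (the relations of the
chart lie in `ker Θ`, `blowupAlgebra.ker_eval_le_ker`). [folklore] -/
theorem isPrime_testPrime :
    ((RingHom.ker (MvPolynomial.eval₂Hom (θ.comp (algebraMap R (Localization.Away ((z ∘ ι) 2))))
      fun j : {j : Fin 4 // j ≠ 2} => θ (blowupAlgebra.frac (z ∘ ι) 2 j.1))).map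
        (blowupAlgebra.eval (z ∘ ι) 2).toRingHom).IsPrime :=
  haveI := RingHom.ker_isPrime (MvPolynomial.eval₂Hom (θ.comp (algebraMap R (Localization.Away ((z ∘ ι) 2))))
      fun j : {j : Fin 4 // j ≠ 2} => θ (blowupAlgebra.frac (z ∘ ι) 2 j.1))
  blowupAlgebra.isPrime_map_eval (z ∘ ι) 2 (blowupAlgebra.ker_eval_le_ker (z ∘ ι) 2 θ)

/-- Membership of values of `eval` in the test prime is membership in `ker Θ`. [folklore] -/
theorem eval_mem_testPrime_iff (m : MvPolynomial {j : Fin 4 // j ≠ 2} R) :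
    blowupAlgebra.eval (z ∘ ι) 2 m ∈
      ((RingHom.ker (MvPolynomial.eval₂Hom (θ.comp (algebraMap R (Localization.Away ((z ∘ ι) 2))))
        fun j : {j : Fin 4 // j ≠ 2} => θ (blowupAlgebra.frac (z ∘ ι) 2 j.1))).map
          (blowupAlgebra.eval (z ∘ ι) 2).toRingHom) ↔
      (MvPolynomial.eval₂Hom (θ.comp (algebraMap R (Localization.Away ((z ∘ ι) 2))))
        fun j : {j : Fin 4 // j ≠ 2} => θ (blowupAlgebra.frac (z ∘ ι) 2 j.1)) m = 0 := by
  rw [← RingHom.mem_ker, ← Ideal.mem_comap]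
  change m ∈ Ideal.comap (blowupAlgebra.eval (z ∘ ι) 2).toRingHom _ ↔ _
  rw [blowupAlgebra.comap_map_eval (z ∘ ι) 2 (blowupAlgebra.ker_eval_le_ker (z ∘ ι) 2 θ)]

/-- **Constants in the test prime**: `r ∈ 𝔯_θ` iff `θ(r) = 0`. [folklore] -/
theorem algebraMap_mem_testPrime_iff (r : R) :
    algebraMap R (blowupAlgebra (Ideal.span (Set.range (z ∘ ι))) ((z ∘ ι) 2)) r ∈
      ((RingHom.ker (MvPolynomial.eval₂Hom (θ.comp (algebraMap R (Localization.Away ((z ∘ ι) 2))))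
        fun j : {j : Fin 4 // j ≠ 2} => θ (blowupAlgebra.frac (z ∘ ι) 2 j.1))).map
          (blowupAlgebra.eval (z ∘ ι) 2).toRingHom) ↔
      θ (algebraMap R (Localization.Away ((z ∘ ι) 2)) r) = 0 := by
  rw [← blowupAlgebra.eval_C (z ∘ ι) 2 r, eval_mem_testPrime_iff, MvPolynomial.eval₂Hom_C, RingHom.comp_apply]

/-- The exceptional equation `z_a` is not in the test prime. [folklore] -/
theorem algebraMap_centre_notMem_testPrime :
    algebraMap R (blowupAlgebra (Ideal.span (Set.range (z ∘ ι))) ((z ∘ ι) 2)) ((z ∘ ι) 2) ∉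
      ((RingHom.ker (MvPolynomial.eval₂Hom (θ.comp (algebraMap R (Localization.Away ((z ∘ ι) 2))))
        fun j : {j : Fin 4 // j ≠ 2} => θ (blowupAlgebra.frac (z ∘ ι) 2 j.1))).map
          (blowupAlgebra.eval (z ∘ ι) 2).toRingHom) := by
  rw [algebraMap_mem_testPrime_iff]
  exact test_centre_ne_zero θ

/-- **Extended ideals killed by `θ` lie in the test prime**: if `θ` vanishes on the generators
`g` then `(g) R[I/z_a] ⊆ 𝔯_θ`. [folklore] -/
theorem map_span_le_testPrime {G : Set R} (hG : ∀ g ∈ G, θ (algebraMap R (Localization.Away ((z ∘ ι) 2)) g) = 0) :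
    (Ideal.span G).map (algebraMap R (blowupAlgebra (Ideal.span (Set.range (z ∘ ι))) ((z ∘ ι) 2))) ≤
      ((RingHom.ker (MvPolynomial.eval₂Hom (θ.comp (algebraMap R (Localization.Away ((z ∘ ι) 2))))
        fun j : {j : Fin 4 // j ≠ 2} => θ (blowupAlgebra.frac (z ∘ ι) 2 j.1))).map
          (blowupAlgebra.eval (z ∘ ι) 2).toRingHom) := by
  rw [Ideal.map_span, Ideal.span_le]
  rintro _ ⟨g, hg, rfl⟩
  exact (algebraMap_mem_testPrime_iff θ g).mpr (hG g hg)

/-- **The strict transform `e₀ e₁ - e₃ h` lies in the test prime** as soon as `θ(z_u) = 0` and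
`θ(h) = 0`. [cite: DeJong1996, 4.27, p. 76] -/
theorem strictTransformT_mem_testPrime {h : R}
    (h0 : θ (algebraMap R (Localization.Away ((z ∘ ι) 2)) ((z ∘ ι) 0)) = 0)
    (hh : θ (algebraMap R (Localization.Away ((z ∘ ι) 2)) h) = 0) :
    blowupAlgebra.frac (z ∘ ι) 2 0 * blowupAlgebra.frac (z ∘ ι) 2 1 -
        blowupAlgebra.frac (z ∘ ι) 2 3 * algebraMap R _ h ∈
      ((RingHom.ker (MvPolynomial.eval₂Hom (θ.comp (algebraMap R (Localization.Away ((z ∘ ι) 2))))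
        fun j : {j : Fin 4 // j ≠ 2} => θ (blowupAlgebra.frac (z ∘ ι) 2 j.1))).map
          (blowupAlgebra.eval (z ∘ ι) 2).toRingHom) := by
  rw [← eval_chartT_poly, eval_mem_testPrime_iff]
  simp only [map_sub, map_mul, MvPolynomial.eval₂Hom_X', MvPolynomial.eval₂Hom_C, RingHom.comp_apply]
  rw [(test_frac_eq_zero_iff θ 0).mpr h0, hh]
  ring

/-- Values of `eval` on the ideal of some variables lie in `Q` once the corresponding fractions
do. [folklore] -/
theorem map_eval_span_X_image_le {s : Set {j : Fin 4 // j ≠ 2}}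
    (Q : Ideal (blowupAlgebra (Ideal.span (Set.range (z ∘ ι))) ((z ∘ ι) 2)))
    (hs : ∀ j ∈ s, blowupAlgebra.frac (z ∘ ι) 2 j.1 ∈ Q) :
    (Ideal.span (MvPolynomial.X '' s)).map (blowupAlgebra.eval (z ∘ ι) 2).toRingHom ≤ Q := by
  rw [Ideal.map_span, Ideal.span_le]
  rintro _ ⟨_, ⟨j, hj, rfl⟩, rfl⟩
  change blowupAlgebra.eval (z ∘ ι) 2 (MvPolynomial.X j) ∈ Q
  rw [blowupAlgebra.eval_X]
  exact hs j hj

end TestMap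

/-! ## The concrete test maps `R → Frac(R/K)` -/

section Concrete

variable {R : Type} [CommRing R] [IsLocalRing R] {N : ℕ} {z : Fin N → R} (hz : IsRsopPart z)
  {ι : Fin 4 → Fin N} (hι : Function.Injective ι)

omit [IsLocalRing R] in
/-- The test map `ψ_K : R → R/K → Frac(R/K)` vanishes exactly on `K`. [folklore] -/
theorem test_comp_mk_eq_zero_iff (K : Ideal R) [K.IsPrime] (r : R) :
    (algebraMap (R ⧸ K) (FractionRing (R ⧸ K))).comp (Ideal.Quotient.mk K) r = 0 ↔ r ∈ K := by
  rw [RingHom.comp_apply, map_eq_zero_iff _ (IsFractionRing.injective (R ⧸ K) (FractionRing (R ⧸ K))),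
    Ideal.Quotient.eq_zero_iff_mem]

omit [IsLocalRing R] in
/-- `ψ_K(z_a)` is a unit when `z_a ∉ K`. [folklore] -/
theorem isUnit_test_comp_mk (K : Ideal R) [K.IsPrime] {a : R} (ha : a ∉ K) :
    IsUnit ((algebraMap (R ⧸ K) (FractionRing (R ⧸ K))).comp (Ideal.Quotient.mk K) a) := by
  rw [isUnit_iff_ne_zero, Ne, test_comp_mk_eq_zero_iff]
  exact ha

omit [IsLocalRing R] in
/-- The extension `θ_K : R[1/z_a] → Frac(R/K)` of `ψ_K` restricts to `ψ_K` on `R`. [folklore] -/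
theorem awayLift_algebraMap (K : Ideal R) [K.IsPrime] {a : R} (ha : a ∉ K) (r : R) :
    Localization.awayLift ((algebraMap (R ⧸ K) (FractionRing (R ⧸ K))).comp (Ideal.Quotient.mk K)) a
        (isUnit_test_comp_mk K ha) (algebraMap R (Localization.Away a) r) =
      (algebraMap (R ⧸ K) (FractionRing (R ⧸ K))).comp (Ideal.Quotient.mk K) r :=
  IsLocalization.Away.lift_eq a (isUnit_test_comp_mk K ha) r

end Concrete

/-! ## Case A: the strict transform of `V(z_u, z_v, z_b, z_k)` -/

/-- **The test prime below `Q`, case A** (`e₃ ∈ Q`: the strict transform of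
`V(z_u, z_v, z_b, z_k)`, "the irreducible component `u' = v' = t₂' = t₃ = 0` … maps onto
`u = v = t₂ = t₃ = 0`"): for the prime `K = (z_k, z_u, z_v, z_b)` of `R` (`k` off the centre)
and a prime `Q ∋ z_a` of `R[I/z_a]` containing `e₀, e₁, e₃` and `z_k`, the test prime `𝔯_{θ_K}` lies
below `Q`. [cite: DeJong1996, 4.27, p. 76] -/
theorem testPrime_le_caseA {R : Type} [CommRing R] {N : ℕ} {z : Fin N → R} {ι : Fin 4 → Fin N} {k : Fin N}
    (Q : Ideal (blowupAlgebra (Ideal.span (Set.range (z ∘ ι))) ((z ∘ ι) 2))) [Q.IsPrime]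
    (h2 : algebraMap R (blowupAlgebra (Ideal.span (Set.range (z ∘ ι))) ((z ∘ ι) 2)) ((z ∘ ι) 2) ∈ Q)
    (hu : blowupAlgebra.frac (z ∘ ι) 2 0 ∈ Q) (hv : blowupAlgebra.frac (z ∘ ι) 2 1 ∈ Q)
    (h3 : blowupAlgebra.frac (z ∘ ι) 2 3 ∈ Q)
    (hkQ : algebraMap R (blowupAlgebra (Ideal.span (Set.range (z ∘ ι))) ((z ∘ ι) 2)) (z k) ∈ Q)
    [(Ideal.span (Set.range (z ∘ Fin.cons k (ι ∘ Fin.succAbove 2)))).IsPrime]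
    (ha : (z ∘ ι) 2 ∉ Ideal.span (Set.range (z ∘ Fin.cons k (ι ∘ Fin.succAbove 2)))) :
    ((RingHom.ker (MvPolynomial.eval₂Hom ((Localization.awayLift ((algebraMap _
      (FractionRing (R ⧸ Ideal.span (Set.range (z ∘ Fin.cons k (ι ∘ Fin.succAbove 2)))))).comp
        (Ideal.Quotient.mk _)) ((z ∘ ι) 2) (isUnit_test_comp_mk _ ha)).comp
          (algebraMap R (Localization.Away ((z ∘ ι) 2))))
      fun j : {j : Fin 4 // j ≠ 2} => (Localization.awayLift ((algebraMap _
      (FractionRing (R ⧸ Ideal.span (Set.range (z ∘ Fin.cons k (ι ∘ Fin.succAbove 2)))))).comp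
        (Ideal.Quotient.mk _)) ((z ∘ ι) 2) (isUnit_test_comp_mk _ ha))
          (blowupAlgebra.frac (z ∘ ι) 2 j.1))).map (blowupAlgebra.eval (z ∘ ι) 2).toRingHom) ≤ Q := by
  -- notation
  set K : Ideal R := Ideal.span (Set.range (z ∘ Fin.cons k (ι ∘ Fin.succAbove 2))) with hK
  set θ := Localization.awayLift ((algebraMap _ (FractionRing (R ⧸ K))).comp (Ideal.Quotient.mk _))
    ((z ∘ ι) 2) (isUnit_test_comp_mk _ ha) with hθ
  have hθr : ∀ r : R, θ (algebraMap R (Localization.Away ((z ∘ ι) 2)) r) = 0 ↔ r ∈ K := fun r => by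
    rw [hθ, awayLift_algebraMap K ha r, test_comp_mk_eq_zero_iff]
  -- the test evaluation kills all three variables
  have hX : ∀ j : {j : Fin 4 // j ≠ 2},
      θ (blowupAlgebra.frac (z ∘ ι) 2 j.1 : Localization.Away ((z ∘ ι) 2)) = 0 := by
    rintro ⟨j, hj⟩
    rw [test_frac_eq_zero_iff, hθr]
    refine Ideal.subset_span ?_
    fin_cases j
    · exact ⟨1, rfl⟩
    · exact ⟨2, rfl⟩
    · exact absurd rfl hj
    · exact ⟨3, rfl⟩
  have hfrac : ∀ j : {j : Fin 4 // j ≠ 2}, blowupAlgebra.frac (z ∘ ι) 2 j.1 ∈ Q := by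
    rintro ⟨j, hj⟩
    fin_cases j
    · exact hu
    · exact hv
    · exact absurd rfl hj
    · exact h3
  -- `K R[I/z_a] ⊆ Q`
  have hKQ : K.map (algebraMap R (blowupAlgebra (Ideal.span (Set.range (z ∘ ι))) ((z ∘ ι) 2))) ≤ Q := by
    rw [hK, Ideal.map_span, Ideal.span_le]
    rintro _ ⟨_, ⟨i, rfl⟩, rfl⟩
    refine Fin.cases ?_ (fun i => ?_) i
    · change algebraMap R _ (z k) ∈ Q
      exact hkQ
    · have hmem : (z ∘ Fin.cons k (ι ∘ Fin.succAbove 2)) i.succ ∈ Ideal.span (Set.range (z ∘ ι)) := by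
        simp only [Function.comp_apply, Fin.cons_succ]
        exact Ideal.subset_span ⟨Fin.succAbove 2 i, rfl⟩
      have := eval_C_mem_of_mem (z ∘ ι) 2 Q h2 _ hmem
      change blowupAlgebra.eval (z ∘ ι) 2 (MvPolynomial.C _) ∈ Q at this
      rwa [blowupAlgebra.eval_C] at this
  intro x hx
  rw [Ideal.mem_map_iff_of_surjective (blowupAlgebra.eval (z ∘ ι) 2).toRingHom
    (fun y => blowupAlgebra.eval_surjective (z ∘ ι) 2 y)] at hx
  obtain ⟨m, hm, rfl⟩ := hx
  rw [RingHom.mem_ker] at hm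
  -- split `m = (m - c₀) + c₀`
  have hsplit : (blowupAlgebra.eval (z ∘ ι) 2).toRingHom m =
      blowupAlgebra.eval (z ∘ ι) 2 (m - MvPolynomial.C (m.coeff 0)) +
        algebraMap R _ (m.coeff 0) := by
    change blowupAlgebra.eval (z ∘ ι) 2 m = _
    rw [map_sub, blowupAlgebra.eval_C, sub_add_cancel]
  rw [hsplit]
  refine Ideal.add_mem _ ?_ ?_
  · refine map_eval_span_X_image_le Q (s := Set.univ) (fun j _ => hfrac j) (Ideal.mem_map_of_mem _ ?_)
    rw [Set.image_univ]
    exact MvPolynomial.sub_C_coeff_zero_mem_span_range_X m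
  · refine hKQ (Ideal.mem_map_of_mem _ ((hθr _).mp ?_))
    -- `Θ (C c₀) = Θ m - Θ (m - C c₀) = 0`
    have hvan : Ideal.span (Set.range (MvPolynomial.X : {j : Fin 4 // j ≠ 2} → MvPolynomial {j : Fin 4 // j ≠ 2} R)) ≤
        RingHom.ker (MvPolynomial.eval₂Hom (θ.comp (algebraMap R (Localization.Away ((z ∘ ι) 2))))
          fun j : {j : Fin 4 // j ≠ 2} => θ (blowupAlgebra.frac (z ∘ ι) 2 j.1)) := by
      rw [Ideal.span_le]
      rintro _ ⟨j, rfl⟩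
      rw [SetLike.mem_coe, RingHom.mem_ker, MvPolynomial.eval₂Hom_X']
      exact hX j
    have h1 := hvan (MvPolynomial.sub_C_coeff_zero_mem_span_range_X m)
    rw [RingHom.mem_ker, map_sub, hm, zero_sub, neg_eq_zero, MvPolynomial.eval₂Hom_C,
      RingHom.comp_apply] at h1
    exact h1


end Summit.ResolutionOfSingularities.ResolutionOfSingularities.Theorems

end
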